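import Summits.MatrixMultiplication.OmegaCensus.SmallFormats.InvertiblePointNearSplit
import Summits.MatrixMultiplication.OmegaCensus.SmallFormats.InvertiblePointDeltaLawRefined
import HarnessLib

/-!
# ω-census family (a): the NEAR-POINT LAW — a near invertible point of an `r`-term `⟨2,2,n⟩` scheme forces `7n ≤ 2r + 2`

Cell `pub-omega` (unit `pub-omega-tensor`, gen 35), topic `Summits/MatrixMultiplication/OmegaCensus` (sub-folder
`SmallFormats`). Framing (verbatim): lottery ticket; floor = certified bounds/negative ranges. HONEST FRAMING: the split of
`InvertiblePointNearSplit` (p664043) fed into the REFINED δ-law of `InvertiblePointDeltaLawRefined` instead of the black-box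
final δ-law: the three defect terms of the split share ONE Y-form (`σ̃ ∝ g_{j₀}`), so on the K-side they cost one dimension, not three.

* (`finrank_inf_ker_add_le`, structural form, field with enough points) at a near `X₀ = 1` (`|O| = 2n + 1`) with relation
  `Σ_O ρ_s W_s = 0`, `ρ_{j₀} ≠ 0`: `dim(K₀ ∩ ker g_{j₀}) + n ≤ dim(span{W_t : t ∉ O} + span{D(E₀₀), D(E₀₁), D(E₁₀)})`,
  `K₀ = ⋂_{t∉O} ker g_t`, `D` the defect output map (`NearSplit.defectOut`) — K-side cost 1, W-side cost = the rank of the defect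
  space modulo `span{W_t}` (at most 3);
* (`seven_mul_le_two_mul_add_two_of_near`, any field, any invertible point) a NEAR point (exactly `2n + 1` nonvanishing X-forms)
  forces **`7n ≤ 2r + 2`** (base change to the algebraic closure, transport to `1`, the structural form with the crude W-side
  bound `|Z| + 3`);
* (`two_mul_add_two_le_card_filter_ne_of_lt`) census form: if `2r + 2 < 7n`, every invertible point has at least `2n + 2`
  nonvanishing X-forms; instances 23-term `⟨2,2,7⟩` (≥ 16), 30-term `⟨2,2,9⟩` (≥ 20), 37-term `⟨2,2,11⟩` (≥ 24).
What is NOT here: the conjectured defect-rank lemma (W-side cost ≤ 2, equivalently `7n ≤ 2r + 1`, which would exclude near points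
at `⟨2,2,6⟩@20`); desk evidence for it is recorded in the cell notes, not in Lean. Nothing on `ω`.
-/

namespace Summit.MatrixMultiplication.OmegaCensus.SmallFormats

open Module Matrix Literature.Computability.AlgebraicComplexity
open Summit.MatrixMultiplication.OmegaCensus.RankOnePlaneCapGeneral

namespace NearSplit

variable {k : Type*} [Field k] {n : ℕ} {ι : Type*} [Fintype ι] [DecidableEq ι]

/-! ## Structural form at `X₀ = 1` -/

/-- **Near-point law, structural form.** At a near `X₀ = 1` (`|O| = 2n + 1`) with output relation `ρ` (`ρ_{j₀} ≠ 0`), over a field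
with more than `|ι| + 2` pairwise independent vectors in `k²`:
`dim(⋂_{t∉O} ker g_t ∩ ker g_{j₀}) + n ≤ dim(span{W_t : t ∉ O} ⊔ span{D(E₀₀), D(E₀₁), D(E₁₀)})`. -/
theorem finrank_inf_ker_add_le (P : ℕ) (xs : Fin (P + 1) → (Fin 2 → k))
    (hxs : ∀ i j, i ≠ j → xs i 0 * xs j 1 - xs i 1 * xs j 0 ≠ 0) (hP : Fintype.card ι + 2 ≤ P)
    (β : BilinComp (mulBilin k 2 2 n) ι) (O : Finset ι)
    (hO : ∀ i, i ∉ O → β.f i 1 = 0) (hO' : ∀ i ∈ O, β.f i 1 ≠ 0) (hcard : O.card = 2 * n + 1)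
    {ρ : ι → k} {j₀ : ι} (hrel : ∑ s ∈ O, ρ s • β.w s = 0) (hj₀ : j₀ ∈ O) (hρ : ρ j₀ ≠ 0) :
    finrank k ↥(LinearMap.ker (LinearMap.pi fun t : ↥(insert j₀ (Finset.univ \ O)) => β.g (t : ι))) + n ≤
      finrank k ↥(Submodule.span k (Set.range fun t : ↥(Finset.univ \ O) => β.w (t : ι)) ⊔
        Submodule.span k (Set.range fun i : Fin 3 => defectOut β ρ (ee i))) := by
  classical
  set β₃ := split (β := β) (ρ := ρ) (j₀ := j₀) O hO hO' hrel hj₀ hρ with hβ₃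
  set O₃ : Finset (ι ⊕ Fin 2) := (O.erase j₀).map Function.Embedding.inl with hO₃
  have hcard₃ : O₃.card = 2 * n := by
    rw [hO₃, Finset.card_map, Finset.card_erase_of_mem hj₀, hcard]; omega
  have hP₃ : Fintype.card (ι ⊕ Fin 2) ≤ P := by rw [Fintype.card_sum, Fintype.card_fin]; exact hP
  have h := DeltaLaw.finrank_ker_add_le_finrank_span P xs hxs hP₃ β₃ O₃
    (split_f_one_eq_zero O hO hO' hrel hj₀ hρ) (split_f_one_ne_zero O hO hO' hrel hj₀ hρ) hcard₃
  -- K-side: `ker g_{j₀} ∩ ⋂ ker g_t` lies in the split's common kernel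
  set K' := LinearMap.ker (LinearMap.pi fun t : ↥(insert j₀ (Finset.univ \ O)) => β.g (t : ι)) with hK'
  set K₃ := LinearMap.ker (LinearMap.pi fun t : ↥(Finset.univ \ O₃) => β₃.g (t : ι ⊕ Fin 2)) with hK₃
  have hKle : K' ≤ K₃ := by
    intro W hW
    rw [hK', LinearMap.mem_ker] at hW
    have hW' : ∀ t, t ∈ insert j₀ (Finset.univ \ O) → β.g t W = 0 := fun t ht => by
      have := congr_fun hW ⟨t, ht⟩
      simpa using this
    have hj : β.g j₀ W = 0 := hW' j₀ (Finset.mem_insert_self _ _)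
    have hZ : ∀ t, t ∉ O → β.g t W = 0 := fun t ht =>
      hW' t (Finset.mem_insert_of_mem (Finset.mem_sdiff.mpr ⟨Finset.mem_univ t, ht⟩))
    rw [hK₃, LinearMap.mem_ker]
    funext t
    obtain ⟨t, ht⟩ := t
    rw [LinearMap.pi_apply, Pi.zero_apply]
    change β₃.g t W = 0
    rcases t with s | i
    · change splitG β ρ j₀ (Sum.inl s) W = 0
      by_cases hs : s = j₀
      · simp only [splitG, Sum.elim_inl, if_pos hs, LinearMap.smul_apply, hj, smul_zero]
      · have hsO : s ∉ O := by
          intro hsO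
          exact (Finset.mem_sdiff.mp ht).2 (Finset.mem_map.mpr ⟨s, Finset.mem_erase.mpr ⟨hs, hsO⟩, rfl⟩)
        simp only [splitG, Sum.elim_inl, if_neg hs, LinearMap.sub_apply, LinearMap.smul_apply, hZ s hsO, hj,
          smul_zero, sub_zero]
    · change splitG β ρ j₀ (Sum.inr i) W = 0
      simp only [splitG, Sum.elim_inr, LinearMap.smul_apply, hj, smul_zero]
  have hKdim : finrank k K' ≤ finrank k K₃ := Submodule.finrank_mono hKle
  -- W-side: the split's vanishing outputs are `W_t` (`t ∉ O`) and the three `D(E_i)`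
  set 𝒲₃ := Submodule.span k (Set.range fun t : ↥(Finset.univ \ O₃) => β₃.w (t : ι ⊕ Fin 2)) with h𝒲₃
  set 𝒲p := Submodule.span k (Set.range fun t : ↥(Finset.univ \ O) => β.w (t : ι)) ⊔
    Submodule.span k (Set.range fun i : Fin 3 => defectOut β ρ (ee i)) with h𝒲p
  have hWle : 𝒲₃ ≤ 𝒲p := by
    rw [h𝒲₃, Submodule.span_le]
    rintro _ ⟨⟨t, ht⟩, rfl⟩
    change β₃.w t ∈ 𝒲p
    rcases t with s | i
    · change splitW β ρ j₀ (Sum.inl s) ∈ 𝒲p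
      by_cases hs : s = j₀
      · simp only [splitW, Sum.elim_inl, if_pos hs]
        exact Submodule.mem_sup_right (Submodule.subset_span ⟨0, rfl⟩)
      · have hsO : s ∉ O := by
          intro hsO
          exact (Finset.mem_sdiff.mp ht).2 (Finset.mem_map.mpr ⟨s, Finset.mem_erase.mpr ⟨hs, hsO⟩, rfl⟩)
        simp only [splitW, Sum.elim_inl, if_neg hs]
        exact Submodule.mem_sup_left (Submodule.subset_span ⟨⟨s, Finset.mem_sdiff.mpr ⟨Finset.mem_univ s, hsO⟩⟩, rfl⟩)
    · change splitW β ρ j₀ (Sum.inr i) ∈ 𝒲p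
      simp only [splitW, Sum.elim_inr]
      exact Submodule.mem_sup_right (Submodule.subset_span ⟨i.succ, rfl⟩)
  have hWdim : finrank k 𝒲₃ ≤ finrank k 𝒲p := Submodule.finrank_mono hWle
  omega

omit [DecidableEq ι] in
/-- Rank–nullity for the K-side: `2n ≤ dim(⋂_{t ∈ S} ker g_t) + |S|`. -/
theorem two_mul_le_finrank_ker_add_card (β : BilinComp (mulBilin k 2 2 n) ι) (S : Finset ι) :
    2 * n ≤ finrank k ↥(LinearMap.ker (LinearMap.pi fun t : ↥S => β.g (t : ι))) + S.card := by
  have h1 := LinearMap.finrank_range_add_finrank_ker (LinearMap.pi fun t : ↥S => β.g (t : ι))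
  rw [finrank_matrix_fin] at h1
  have h2 : finrank k (LinearMap.range (LinearMap.pi fun t : ↥S => β.g (t : ι))) ≤ S.card :=
    calc finrank k (LinearMap.range (LinearMap.pi fun t : ↥S => β.g (t : ι)))
        ≤ finrank k (↥S → k) := Submodule.finrank_le _
      _ = S.card := by rw [finrank_fintype_fun_eq_card, Fintype.card_coe]
  omega

/-- The crude W-side bound: `dim(span{W_t : t ∉ O} ⊔ span{D(E_i)}) ≤ |Z| + 3`. -/
theorem finrank_sup_defect_le (β : BilinComp (mulBilin k 2 2 n) ι) (O : Finset ι) (ρ : ι → k) :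
    finrank k ↥(Submodule.span k (Set.range fun t : ↥(Finset.univ \ O) => β.w (t : ι)) ⊔
        Submodule.span k (Set.range fun i : Fin 3 => defectOut β ρ (ee i))) ≤
      (Fintype.card ι - O.card) + 3 := by
  refine (Submodule.finrank_add_le_finrank_add_finrank _ _).trans (add_le_add ?_ ?_)
  · refine (finrank_range_le_card _).trans ?_
    rw [Fintype.card_coe, Finset.card_sdiff, Finset.inter_univ, Finset.card_univ]
  · exact (finrank_range_le_card _).trans (by rw [Fintype.card_fin])

/-- **Near point at `X₀ = 1` ⇒ `7n ≤ 2r + 2`** (field with enough points). -/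
theorem seven_mul_le_two_mul_add_two_of_near_one (P : ℕ) (xs : Fin (P + 1) → (Fin 2 → k))
    (hxs : ∀ i j, i ≠ j → xs i 0 * xs j 1 - xs i 1 * xs j 0 ≠ 0) (hP : Fintype.card ι + 2 ≤ P)
    (β : BilinComp (mulBilin k 2 2 n) ι) (O : Finset ι)
    (hO : ∀ i, i ∉ O → β.f i 1 = 0) (hO' : ∀ i ∈ O, β.f i 1 ≠ 0) (hcard : O.card = 2 * n + 1) :
    7 * n ≤ 2 * Fintype.card ι + 2 := by
  classical
  obtain ⟨ρ, hrel, j₀, hj₀, hρ⟩ := exists_relation β O (by omega)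
  have h := finrank_inf_ker_add_le P xs hxs hP β O hO hO' hcard hrel hj₀ hρ
  have hK := two_mul_le_finrank_ker_add_card β (insert j₀ (Finset.univ \ O))
  have hS : (insert j₀ (Finset.univ \ O)).card = Fintype.card ι - O.card + 1 := by
    rw [Finset.card_insert_of_notMem (fun h => (Finset.mem_sdiff.mp h).2 hj₀), Finset.card_sdiff, Finset.inter_univ,
      Finset.card_univ]
  have hW := finrank_sup_defect_le β O ρ
  have hOle : O.card ≤ Fintype.card ι := Finset.card_le_univ O
  omega

section AnyField

variable [DecidableEq k]

/-- **THE NEAR-POINT LAW (any field).** If an `r`-term bilinear computation of `⟨2,2,n⟩` has an invertible `X₀` at which exactly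
`2n + 1` X-forms are nonzero (one vanishing form short of the cap), then `7n ≤ 2r + 2`. -/
theorem seven_mul_le_two_mul_add_two_of_near (β : BilinComp (mulBilin k 2 2 n) ι) (X₀ : Matrix (Fin 2) (Fin 2) k)
    (hX₀ : IsUnit X₀.det) (hnear : (Finset.univ.filter fun i => β.f i X₀ ≠ 0).card = 2 * n + 1) :
    7 * n ≤ 2 * Fintype.card ι + 2 := by
  classical
  let L := AlgebraicClosure k
  let φ : k →+* L := algebraMap k L
  let β₁ := DeltaLaw.baseChange22n φ β
  have hX₁ : IsUnit (X₀.map φ).det := DeltaLaw.isUnit_det_map φ hX₀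
  have hnear₁ : (Finset.univ.filter fun i => β₁.f i (X₀.map φ) ≠ 0).card = 2 * n + 1 := by
    rw [show (Finset.univ.filter fun i => β₁.f i (X₀.map φ) ≠ 0).card =
      (Finset.univ.filter fun i => β.f i X₀ ≠ 0).card by convert DeltaLaw.card_filter_baseChange φ β X₀]
    exact hnear
  obtain ⟨β₂, hf, -, -⟩ := exists_XsideTransform β₁ (X₀.map φ) (X₀.map φ)⁻¹ 1 1
    (Matrix.mul_nonsing_inv _ hX₁) (Matrix.one_mul 1)
  have hf1 : ∀ i, β₂.f i 1 = β₁.f i (X₀.map φ) := fun i => by rw [hf, Matrix.mul_one, Matrix.mul_one]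
  set O := Finset.univ.filter fun i => β₁.f i (X₀.map φ) ≠ 0 with hOdef
  have hO : ∀ i, i ∉ O → β₂.f i 1 = 0 := fun i hi => by
    rw [hf1]; by_contra h; exact hi (Finset.mem_filter.mpr ⟨Finset.mem_univ i, h⟩)
  have hO' : ∀ i ∈ O, β₂.f i 1 ≠ 0 := fun i hi => by rw [hf1]; exact (Finset.mem_filter.mp hi).2
  let emb := Infinite.natEmbedding L
  let a : Fin (Fintype.card ι + 2 + 1) → L := fun i => emb i
  have ha : Function.Injective a := fun i j h => Fin.ext (emb.injective h)
  exact seven_mul_le_two_mul_add_two_of_near_one (Fintype.card ι + 2) (fun i => ![1, a i])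
    (DeltaLaw.pairwise_indep_of_injective a ha) le_rfl β₂ O hO hO' hnear₁

/-- **Census form (any field).** If `2r + 2 < 7n`, an `r`-term computation of `⟨2,2,n⟩` has neither a saturated nor a near invertible
point: at every invertible `X₀` at least `2n + 2` X-forms are nonzero (at most `r − 2n − 2` vanish). -/
theorem two_mul_add_two_le_card_filter_ne_of_lt (β : BilinComp (mulBilin k 2 2 n) ι) (h7 : 2 * Fintype.card ι + 2 < 7 * n)
    (X₀ : Matrix (Fin 2) (Fin 2) k) (hX₀ : IsUnit X₀.det) :
    2 * n + 2 ≤ (Finset.univ.filter fun i => β.f i X₀ ≠ 0).card := by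
  have h1 : 2 * n + 1 ≤ (Finset.univ.filter fun i => β.f i X₀ ≠ 0).card :=
    DeltaLaw.two_mul_add_one_le_card_filter_ne_of_lt β (by omega) X₀ hX₀
  rcases Nat.lt_or_ge (2 * n + 1) (Finset.univ.filter fun i => β.f i X₀ ≠ 0).card with h | h
  · exact h
  · have heq : (Finset.univ.filter fun i => β.f i X₀ ≠ 0).card = 2 * n + 1 := le_antisymm h h1
    have := seven_mul_le_two_mul_add_two_of_near β X₀ hX₀ heq
    omega

/-- **23-term `⟨2,2,7⟩` (any field): at every invertible point at least 16 of the 23 X-forms are nonzero** (`48 < 49`). -/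
theorem sixteen_le_card_filter_ne_227_23 (β : BilinComp (mulBilin k 2 2 7) ι) (hι : Fintype.card ι = 23)
    (X₀ : Matrix (Fin 2) (Fin 2) k) (hX₀ : IsUnit X₀.det) : 16 ≤ (Finset.univ.filter fun i => β.f i X₀ ≠ 0).card :=
  two_mul_add_two_le_card_filter_ne_of_lt β (by rw [hι]; norm_num) X₀ hX₀

/-- **30-term `⟨2,2,9⟩` (any field; the floor rung `⌈36·9/11⌉`): at least 20 of the 30 X-forms are nonzero at every invertible
point** (`62 < 63`; the plain cap gives 18, the δ-law 19). -/
theorem twenty_le_card_filter_ne_229_30 (β : BilinComp (mulBilin k 2 2 9) ι) (hι : Fintype.card ι = 30)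
    (X₀ : Matrix (Fin 2) (Fin 2) k) (hX₀ : IsUnit X₀.det) : 20 ≤ (Finset.univ.filter fun i => β.f i X₀ ≠ 0).card :=
  two_mul_add_two_le_card_filter_ne_of_lt β (by rw [hι]; norm_num) X₀ hX₀

/-- **37-term `⟨2,2,11⟩` (any field): at least 24 of the 37 X-forms are nonzero at every invertible point** (`76 < 77`). -/
theorem twentyfour_le_card_filter_ne_2211_37 (β : BilinComp (mulBilin k 2 2 11) ι) (hι : Fintype.card ι = 37)
    (X₀ : Matrix (Fin 2) (Fin 2) k) (hX₀ : IsUnit X₀.det) : 24 ≤ (Finset.univ.filter fun i => β.f i X₀ ≠ 0).card :=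
  two_mul_add_two_le_card_filter_ne_of_lt β (by rw [hι]; norm_num) X₀ hX₀

end AnyField

end NearSplit

end Summit.MatrixMultiplication.OmegaCensus.SmallFormats
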